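import Literature.NumberTheory.LFunctions.DedekindZetaZeroFreeRegionUniform
import HarnessLib

/-!
# Thorner–Zaman's Theorem 3.1 for the Hilbert class field: the exceptional zero, uniformly in `K`

Topic `Literature/NumberTheory/LFunctions` (namespace `Literature.NumberTheory.LFunctions.NumberField`).
Everything in this file is PROVED (theorems only; no definitions, no named facts).

For a number field `K` and its class group characters `χ : Cl_K →* ℂˣ`, the product
`∏_χ L(s, χ)` is the Dedekind zeta function of the Hilbert class field `H_K` (Artin; not used
here).  [ThornerZaman2019, Theorem 3.1] (Weiss; Lagarias–Montgomery–Odlyzko) for `L = H_K` says: for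
`Q ≥ 3` (here every `L(s, χ)` is unramified, `Q = D_K`) the product has AT MOST ONE zero in the
region `σ > 1 − c/log(QT^{n_K})`, `|t| ≤ T`; if it exists it is real, simple, and belongs to a real
character.  This file assembles exactly that from the uniform results of the tree, with
`ℒ(t) = log|d_K| + log(|t| + 4)` and a constant `c = c(n) > 0` depending on the DEGREE alone (the
dependence `QT^{n_K}` of TZ being absorbed into `c(n)`): writing "`ρ` is a zero of the factor `χ`"
for `L₀(ρ, χ) = 0` if `χ ≠ 1` (`L₀ = ` the entire `L(s, χ)`, `ClassGroupLFunctionEntire.lean`) and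
`ζ₁_K(ρ) = 0` if `χ = 1` (`ζ₁_K = (s − 1)ζ_K`),

* `exceptionalZero_real` — every such zero with `Re ρ > 1 − c/ℒ(Im ρ)` is REAL and its character
  is REAL (`exists_zeroFree_classGroupLFunction₀`, `exists_zeroFree_dedekindZeta₁`);
* `exceptionalZero_unique` — two such zeros `(χ₁, ρ₁)`, `(χ₂, ρ₂)` coincide: `χ₁ = χ₂` and `ρ₁ = ρ₂`
  (at most one real zero per factor, Landau–Page across the factors, including `ζ_K`:
  `ClassGroupLFunctionRealZeros.lean`, `DedekindZetaRealZerosUniform.lean`);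
* `exceptionalZero_simple` — it is a simple zero (`ClassGroupLFunctionExceptionalZeroSimple.lean`,
  `exists_realZero_simple_dedekindZeta₁`);
* `exists_exceptionalZero_const` — the three statements with ONE constant `c(n)`.

What is NOT here: Stark's lower bound `1 − β₁ ≫ Q^{−N}` ([ThornerZaman2019, Theorem 3.4]) — for
real class group characters of imaginary quadratic fields it requires genus theory; for `ζ_K` of a
quadratic field a Siegel bound is `Quadratic.exists_one_sub_realZero_dedekindZetaCont_ge`.

## References

* J. Thorner, A. Zaman, *A unified and improved Chebotarev density theorem*, Algebra & Number
  Theory 13 (2019), Theorem 3.1. [ThornerZaman2019]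
* J. C. Lagarias, H. L. Montgomery, A. M. Odlyzko, *A bound for the least prime ideal in the
  Chebotarev density theorem*, Invent. Math. 54 (1979). [folklore]
* H. L. Montgomery, R. C. Vaughan, *Multiplicative Number Theory I*, CUP 2007, §11.1–11.2.
  [MontgomeryVaughan2007]
-/

noncomputable section

open scoped NumberField nonZeroDivisors
open Complex Filter Topology Set Metric NumberField

namespace Literature.NumberTheory.LFunctions.NumberField

/-- **TZ Theorem 3.1 for `H_K/K`, with one constant**: for every `n` there is `c = c(n) > 0` such
that for every number field `K` of degree `n`, writing `Z(χ, ρ)` for "`ρ` is a zero of the factor `χ`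
of `ζ_K ∏_{χ ≠ 1} L(s, χ)` with `Re ρ > 1 − c/(log|d_K| + log(|Im ρ| + 4))`":
(1) `Z(χ, ρ) → Im ρ = 0 ∧ χ² = 1`; (2) `Z(χ₁, ρ₁) → Z(χ₂, ρ₂) → χ₁ = χ₂ ∧ ρ₁ = ρ₂`;
(3) `Z(χ, ρ) →` the zero is simple (`ord = 1`). [cite: ThornerZaman2019, Theorem 3.1] -/
theorem exists_exceptionalZero_const (n : ℕ) :
    ∃ c : ℝ, 0 < c ∧ ∀ (K : Type) [Field K] [NumberField K], Module.finrank ℚ K = n →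
      let Z : (ClassGroup (𝓞 K) →* ℂˣ) → ℂ → Prop := fun χ ρ ↦
        ((χ = 1 → dedekindZeta₁ K ρ = 0) ∧ (χ ≠ 1 → classGroupLFunction₀ K χ ρ = 0)) ∧
          1 - c / (Real.log ((discr K).natAbs : ℝ) + Real.log (|ρ.im| + 4)) < ρ.re
      (∀ χ ρ, Z χ ρ → ρ.im = 0 ∧ χ * χ = 1) ∧
      (∀ χ₁ χ₂ ρ₁ ρ₂, Z χ₁ ρ₁ → Z χ₂ ρ₂ → χ₁ = χ₂ ∧ ρ₁ = ρ₂) ∧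
      (∀ χ ρ, Z χ ρ → (χ = 1 → analyticOrderAt (dedekindZeta₁ K) ρ = 1) ∧
        (χ ≠ 1 → analyticOrderAt (classGroupLFunction₀ K χ) ρ = 1)) := by
  obtain ⟨c₁, hc₁, hZF⟩ := exists_zeroFree_classGroupLFunction₀ n
  obtain ⟨c₂, hc₂, hZFζ⟩ := exists_zeroFree_dedekindZeta₁ n
  obtain ⟨c₃, hc₃, hmin⟩ := exists_min_realZeros_classGroupLFunction₀_le n
  obtain ⟨c₄, hc₄, hlan⟩ := exists_landau_classGroupLFunction₀ n
  obtain ⟨c₅, hc₅, hminζ⟩ := exists_min_realZeros_dedekindZeta₁_le n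
  obtain ⟨c₆, hc₆, hlanζ⟩ := exists_landau_dedekindZeta₁_classGroupLFunction₀ n
  obtain ⟨c₇, hc₇, hsim⟩ := exists_realZero_simple_classGroupLFunction₀ n
  obtain ⟨c₈, hc₈, hsimζ⟩ := exists_realZero_simple_dedekindZeta₁ n
  set c : ℝ := min (min (min c₁ c₂) (min c₃ c₄)) (min (min c₅ c₆) (min c₇ c₈)) with hcdef
  have hc : 0 < c := by positivity
  have h1 : c ≤ c₁ := by simp [hcdef]
  have h2 : c ≤ c₂ := by simp [hcdef]
  have h3 : c ≤ c₃ := by simp [hcdef]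
  have h4 : c ≤ c₄ := by simp [hcdef]
  have h5 : c ≤ c₅ := by simp [hcdef]
  have h6 : c ≤ c₆ := by simp [hcdef]
  have h7 : c ≤ c₇ := by simp [hcdef]
  have h8 : c ≤ c₈ := by simp [hcdef]
  refine ⟨c, hc, fun K _ _ hK ↦ ?_⟩
  intro Z
  have hd1 : (1 : ℝ) ≤ ((discr K).natAbs : ℝ) := by
    have h := Int.one_le_abs (NumberField.discr_ne_zero K)
    rw [Int.abs_eq_natAbs] at h
    exact_mod_cast h
  -- comparison of regions: a smaller constant gives a smaller region
  have hreg : ∀ {c' : ℝ} (ρ : ℂ), c ≤ c' →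
      1 - c / (Real.log ((discr K).natAbs : ℝ) + Real.log (|ρ.im| + 4)) < ρ.re →
      1 - c' / (Real.log ((discr K).natAbs : ℝ) + Real.log (|ρ.im| + 4)) < ρ.re := by
    intro c' ρ hcc' h
    have hℒ := TwistedZFR.ell_pos hd1 ρ.im
    have := div_le_div_of_nonneg_right hcc' hℒ.le
    linarith
  -- at height `0` the window `1 − c/ℒ₀` contains `Re ρ` when `Im ρ = 0`
  have hreg0 : ∀ {c' : ℝ} (ρ : ℂ), c ≤ c' → ρ.im = 0 →
      1 - c / (Real.log ((discr K).natAbs : ℝ) + Real.log (|ρ.im| + 4)) < ρ.re →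
      1 - c' / (Real.log ((discr K).natAbs : ℝ) + Real.log 4) < ρ.re := by
    intro c' ρ hcc' him h
    have h' := hreg ρ hcc' h
    rwa [him, abs_zero, zero_add] at h'
  -- (1) reality
  have hreal : ∀ χ ρ, Z χ ρ → ρ.im = 0 ∧ χ * χ = 1 := by
    rintro χ ρ ⟨⟨hz1, hz2⟩, hregion⟩
    by_cases hχ : χ = 1
    · refine ⟨hZFζ K hK ρ (hz1 hχ) (hreg ρ h2 hregion), ?_⟩
      rw [hχ]; exact mul_one (1 : ClassGroup (𝓞 K) →* ℂˣ)
    · have := hZF K hK χ hχ ρ (hz2 hχ) (hreg ρ h1 hregion)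
      exact ⟨this.2, this.1⟩
  refine ⟨hreal, ?_, ?_⟩
  · -- (2) uniqueness
    intro χ₁ χ₂ ρ₁ ρ₂ hZ₁ hZ₂
    obtain ⟨him₁, hsq₁⟩ := hreal χ₁ ρ₁ hZ₁
    obtain ⟨him₂, hsq₂⟩ := hreal χ₂ ρ₂ hZ₂
    obtain ⟨⟨hz₁1, hz₁2⟩, hregion₁⟩ := hZ₁
    obtain ⟨⟨hz₂1, hz₂2⟩, hregion₂⟩ := hZ₂
    have hρ₁ : ρ₁ = (ρ₁.re : ℂ) := by
      apply Complex.ext <;> simp [him₁]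
    have hρ₂ : ρ₂ = (ρ₂.re : ℂ) := by
      apply Complex.ext <;> simp [him₂]
    -- the key: the two real parts cannot both lie in the window unless `(χ₁, ρ₁) = (χ₂, ρ₂)`
    have hcontra : ∀ {c' : ℝ}, c ≤ c' →
        ¬ min ρ₁.re ρ₂.re ≤ 1 - c' / (Real.log ((discr K).natAbs : ℝ) + Real.log 4) := by
      intro c' hcc' hle
      have h₁ := hreg0 ρ₁ hcc' him₁ hregion₁
      have h₂ := hreg0 ρ₂ hcc' him₂ hregion₂
      have : 1 - c' / (Real.log ((discr K).natAbs : ℝ) + Real.log 4) < min ρ₁.re ρ₂.re := lt_min h₁ h₂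
      linarith
    by_cases hχ₁ : χ₁ = 1 <;> by_cases hχ₂ : χ₂ = 1
    · -- both `ζ_K`
      refine ⟨hχ₁.trans hχ₂.symm, ?_⟩
      by_contra hne
      have hne' : ρ₁.re ≠ ρ₂.re := fun h ↦ hne (by rw [hρ₁, hρ₂, h])
      have hz₁ : dedekindZeta₁ K ρ₁.re = 0 := by rw [← hρ₁]; exact hz₁1 hχ₁
      have hz₂ : dedekindZeta₁ K ρ₂.re = 0 := by rw [← hρ₂]; exact hz₂1 hχ₂
      exact hcontra h5 (hminζ K hK ρ₁.re ρ₂.re hne' hz₁ hz₂)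
    · -- `ζ_K` and `L(s, χ₂)`
      exfalso
      have hz₁ : dedekindZeta₁ K ρ₁.re = 0 := by rw [← hρ₁]; exact hz₁1 hχ₁
      have hz₂ : classGroupLFunction₀ K χ₂ ρ₂.re = 0 := by rw [← hρ₂]; exact hz₂2 hχ₂
      exact hcontra h6 (hlanζ K hK χ₂ hχ₂ ρ₁.re ρ₂.re hz₁ hz₂)
    · exfalso
      have hz₂ : dedekindZeta₁ K ρ₂.re = 0 := by rw [← hρ₂]; exact hz₂1 hχ₂
      have hz₁ : classGroupLFunction₀ K χ₁ ρ₁.re = 0 := by rw [← hρ₁]; exact hz₁2 hχ₁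
      have := hlanζ K hK χ₁ hχ₁ ρ₂.re ρ₁.re hz₂ hz₁
      rw [min_comm] at this
      exact hcontra h6 this
    · -- two class group characters
      have hz₁ : classGroupLFunction₀ K χ₁ ρ₁.re = 0 := by rw [← hρ₁]; exact hz₁2 hχ₁
      have hz₂ : classGroupLFunction₀ K χ₂ ρ₂.re = 0 := by rw [← hρ₂]; exact hz₂2 hχ₂
      by_cases hχ : χ₁ = χ₂
      · refine ⟨hχ, ?_⟩
        subst hχ
        by_contra hne
        have hne' : ρ₁.re ≠ ρ₂.re := fun h ↦ hne (by rw [hρ₁, hρ₂, h])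
        exact hcontra h3 (hmin K hK χ₁ hχ₁ ρ₁.re ρ₂.re hne' hz₁ hz₂)
      · exfalso
        exact hcontra h4 (hlan K hK χ₁ χ₂ hχ₁ hχ₂ hsq₁ hsq₂ hχ ρ₁.re ρ₂.re hz₁ hz₂)
  · -- (3) simplicity
    intro χ ρ hZ
    obtain ⟨him, -⟩ := hreal χ ρ hZ
    obtain ⟨⟨hz1, hz2⟩, hregion⟩ := hZ
    have hρ : ρ = (ρ.re : ℂ) := by
      apply Complex.ext <;> simp [him]
    have hwin : ∀ {c' : ℝ}, c ≤ c' → ¬ ρ.re ≤ 1 - c' / (Real.log ((discr K).natAbs : ℝ) + Real.log 4) := by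
      intro c' hcc' hle
      have := hreg0 ρ hcc' him hregion
      linarith
    -- order is `≥ 1` (a zero) and `< 2`
    have hord : ∀ {f : ℂ → ℂ}, Differentiable ℂ f → f ρ = 0 →
        (¬ (2 : ℕ∞) ≤ analyticOrderAt f ρ) → analyticOrderAt f ρ ≠ ⊤ → analyticOrderAt f ρ = 1 := by
      intro f hf hz h2 htop
      have hne0 : analyticOrderAt f ρ ≠ 0 := by
        rw [ne_eq, (hf.analyticAt ρ).analyticOrderAt_eq_zero, not_not]; exact hz
      obtain ⟨k, hk⟩ := ENat.ne_top_iff_exists.mp htop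
      rw [← hk] at hne0 h2 ⊢
      have h2' : ¬ 2 ≤ k := fun h ↦ h2 (by exact_mod_cast h)
      have h0' : k ≠ 0 := fun h ↦ hne0 (by rw [h]; rfl)
      have : k = 1 := by omega
      rw [this]; rfl
    constructor
    · intro hχ
      have hz := hz1 hχ
      refine hord (dedekindZeta₁_differentiable K) hz (fun h2 ↦ ?_) (analyticOrderAt_dedekindZeta₁_ne_top ρ)
      have h2' : (2 : ℕ∞) ≤ analyticOrderAt (dedekindZeta₁ K) (ρ.re : ℂ) := by rw [← hρ]; exact h2
      exact hwin h8 (hsimζ K hK ρ.re h2')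
    · intro hχ
      have hz := hz2 hχ
      refine hord (differentiable_classGroupLFunction₀ χ) hz (fun h2 ↦ ?_) ?_
      · have h2' : (2 : ℕ∞) ≤ analyticOrderAt (classGroupLFunction₀ K χ) (ρ.re : ℂ) := by rw [← hρ]; exact h2
        have hz' : classGroupLFunction₀ K χ (ρ.re : ℂ) = 0 := by rw [← hρ]; exact hz
        exact hwin h7 (hsim K hK χ hχ ρ.re hz' h2')
      · -- `L₀(·, χ)` is not locally zero: `ord_ρ L₀ = ord_ρ Z₁_χ < ⊤` off `ρ = 1`, and `L₀(1) ≠ 0`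
        by_cases hρ1 : ρ = 1
        · rw [hρ1] at hz; exact absurd hz (classGroupLFunction₀_one_ne_zero hχ)
        · rw [← analyticOrderAt_classTwistedZeta₁_eq hχ hρ1]
          exact analyticOrderAt_classTwistedZeta₁_ne_top χ ρ

end Literature.NumberTheory.LFunctions.NumberField

end
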